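/-
Copyright: cell `pub-balaban-gaps` (G2), seat ne6 (row NE7b), `prover-pub-balaban-gaps-ne6-g15-0`, on leaf-01 g80's `CompactFibreRelative`
(OWNER lineage `t4-ne7b-p1` g106's `CompactFibreCarrier`). Project licence.
-/
import Summits.QuantumFields.BalabanUV.T4Continuum.Spine.NE7b.CompactFibreCreationFloorSU2
import Summits.QuantumFields.BalabanUV.T4Continuum.Spine.NE7b.CompactFibreWindowSUN

/-!
# THE (n)-CARRIER'S CREATION-STEP PRICE ON THE `SU(N)` PRODUCT FIBRE, ALL `N`, WITH THE WINDOW-VOLUME LETTER ABSTRACT: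
# `∫ F·w·e^{−I} ≤ exp(i₀ − (λ∕2)δ′² + b_vol)·(∫F dκ)·∫ G·w·e^{−I}`, `b_vol ≥ −log κ(Π_b{‖V − 1‖_HS ≤ η})` — valued TODAY by `CompactFibreWindowSUN`
# (`#bonds·(N²·log(2∕η) − log C)`) and at print's rate by `CompactFibreWindowSUNRate` (`#bonds·((N² − 1)·log η⁻¹ + c)`) (row NE7b, node U5c; MODEL, [folklore])

Cell `pub-balaban-gaps` (G2 spine census, V32) for the `pub-balaban` T⁴ crux NE7b (`T4WeightBudget.RelWeightBound`; the cell's OWN estimate — NOT PRINTED in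
[Bałaban 1983–89], NOT PROVED).  Crux-route MODEL work under `Spine/NE7b/`; NOTHING of Bałaban's is named as a hypothesis or asserted; no `def`; zero `sorry`.
Imports (oleans present): this seat's `CompactFibreCreationFloorSU2` (V25: the `SU(2)` model, `price_with_volume_le`; through it leaf-01's `CompactFibreRelative`:
`relFibre_moment_le_of_centredWindow` ∕ `_of_centredProfile`, the fibrewise-relative compact sandwich on a GROUP fibre with a left-invariant measure) and
`CompactFibreWindowSUN` (V20: the Hilbert–Schmidt window of `SU(N)`, `measurableSet_sball`, `exists_neg_log_pi_sball_le`).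

WHY.  V25 `creationPrice_SU2` prices the creation step of the (n)-carrier BY VALUE in the `SU(2) ↔ S³ ⊂ ℍ` model (quaternion distance, trace window, V19's
rate-2 letter).  The headline `…T4ContinuumYM4Torus.continuumYM4_torus_of_BetaPertH` is stated for `SU(N)`, every `N`.  The sandwich is generic (leaf-01), the
deviation and the window are Hilbert–Schmidt distances on the matrices (`CompactFibreWindowCentredSUN`), and the volume letter for `SU(N)` exists in two strengths
(V20: exponent `N²`; V29 `CompactFibreWindowSUNRate`: print's `N² − 1`, BY NAME from the tree's [VaropoulosSaloffcosteCoulhon1993] Thm. V.4.1).  THIS FILE types the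
all-`N` price with the letter ABSTRACT (`hWpos`, `hvol`), so that either valuation is one line, and values it today from V20.

WHAT IS PROVED ([folklore]), near fibre `K = (bonds → SU(N))` with the product Haar probability `κ`, far space `(Y, μ)` s-finite, window
`W_η = Π_b {V : SU(N) | ‖V − 1‖_HS ≤ η}` about a fibrewise centre `U₀ : Y → K`, deviation of bond `b` = `‖(U₀ y b)⁻¹·x b − 1‖_HS` (= `‖x b − U₀ y b‖_HS`,
`CompactFibreWindowCentredSUN.norm_coe_inv_mul_sub_one`):
* **`creationPrice_SUN_of_volumeLetter`** — numerator supported where SOME bond deviates by `≥ δ′` (print's `1 − χ′`, [Balaban1989LargeFieldI] (1.82)), a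
  bond-quadratic convexity floor of modulus `λ` from the base level `m₀ y` there, the denominator factor `≥ 1` and the interaction excess `≤ i₀` on the centred
  window, and a volume letter `0 < κ(W_η)`, `−log κ(W_η) ≤ b_vol`: `∫ F·w·e^{−I} ≤ exp(i₀ − (λ∕2)δ′² + b_vol)·(∫F dκ)·∫ G·w·e^{−I}`.
* **`exists_creationPrice_SUN`** — BY VALUE today (V20's letter): `∃ C > 0, ∀ 0 < η ≤ 2`, the price with `b_vol = #bonds·(N²·log(2∕η) − log C)`.
* `creationPrice_factor_le_exp_neg_of_volumeLetter` — with `∫F dκ ≤ 1` the factor is `≤ e^{−P}` as soon as `P + i₀ + b_vol ≤ (λ∕2)δ′²` (the ledger row; with V29's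
  letter and `#bonds ∝ ℓ^{4r₀}` this is `CreationLedgerPowerCounting` v2's `creation_ledger_print_regime_SUN`).
* **`creationPrice_SUN_profile`** — print's own shape ([Balaban1989LargeFieldII] (1.2)): the denominator's Gaussian INTEGRATED as a profile `q` on the window, price
  `e^{−(λ∕2)δ′²}·(∫F dκ ∕ ∫_W e^{−q} dκ)`, no `i₀`, no letter (leaf-01's `relFibre_moment_le_of_centredProfile` BY NAME).

HONEST REMARKS.  MODEL only (`SU(N)`, product Haar, Hilbert–Schmidt windows).  Nothing of Bałaban's asserted; which `η(g_k)`, `δ′_k = g_kA₁p₁(g_k)`, `λ` (print: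
`γ₀W⁻¹` of (1.77)∕(1.78), `γ₀` = GAPS G-B9-09), `i₀` (`CompactFibreWindowCentredSUN.abs_excess_le_of_centredWindow`: `(β∕2)(4ρ)(2s + 4ρ)` per plaquette) print's step
carries and that its carrier IS this one are (A3) ∕ (A1c), NC-NE7b-α UNRULED.  BY-NAME EFFECT ON THE WALL: NONE.  NE7b NOT PRINTED ∕ NOT PROVED; spine PROVED 0∕9;
rung (B)+1 on ONE finite T⁴ — NOT infinite volume, NOT the mass gap, NOT Clay.
HONEST DEPENDENCY: continuum YM on T⁴ ⇐ BetaPertH ∧ nine spine estimates (0/9 proved); BetaPertH ⇐ (D1) ∧ (D4) ∧ CAP+tail;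
G-an2-4 gates asym, D1 and NE2/3/4.  This file changes none of it.
-/

set_option autoImplicit false

noncomputable section

open MeasureTheory Real Finset
open scoped Matrix.Norms.Frobenius
open Literature.MathematicalPhysics.QuantumFieldTheory (haarProbability)
open Summit.QuantumFields.BalabanUV.T4Continuum.NE7b.CompactFibreRelative (relFibre_moment_le_of_centredWindow relFibre_moment_le_of_centredProfile)
open Summit.QuantumFields.BalabanUV.T4Continuum.NE7b.CompactFibreCreationFloorSU2 (price_with_volume_le)
open Summit.QuantumFields.BalabanUV.T4Continuum.NE7b.CompactFibreWindowSUN (measurableSet_sball exists_neg_log_pi_sball_le)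

namespace Summit.QuantumFields.BalabanUV.T4Continuum.NE7b.CompactFibreCreationFloorSUN

variable {N : ℕ} {B : Type*} [Fintype B] {Y : Type*} [MeasurableSpace Y] (μ : Measure Y) [SFinite μ]

/-! ## §1 The creation-step price on the `SU(N)` product fibre, volume letter abstract -/

/-- **THE (n)-CARRIER'S CREATION-STEP PRICE, `SU(N)` MODEL, ALL `N`, VOLUME LETTER ABSTRACT.**  Near fibre `bonds → SU(N)` with the product Haar probability, far
space `(Y, μ)`; numerator factor `F ≥ 0` (integrable), denominator factor `G ≥ 0`, far weight `w ≥ 0`, interaction `I`, fibrewise centre `U₀`, Hilbert–Schmidt window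
half-width `η`; per live fibre (`w y ≠ 0`): the denominator factor dominates the centred product window (`hGwin`), the interaction's excess over a base level `m₀ y` is
`≤ i₀` there (`hIrel`), the numerator lives where SOME bond is at Hilbert–Schmidt distance `≥ δ′ ≥ 0` from the centre (`hF`), and a bond-quadratic convexity floor of
modulus `λ ≥ 0` from the same base level holds there (`hconv`); the window's volume letter: `0 < κ(W_η)` and `−log κ(W_η) ≤ b_vol`.
Then `∫ F·w·e^{−I} ≤ exp(i₀ − (λ∕2)δ′² + b_vol)·(∫F dκ)·∫ G·w·e^{−I}`. [folklore] -/
theorem creationPrice_SUN_of_volumeLetter {η bvol : ℝ} (F G : (B → Matrix.specialUnitaryGroup (Fin N) ℂ) → ℝ) (w : Y → ℝ)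
    (I : (B → Matrix.specialUnitaryGroup (Fin N) ℂ) × Y → ℝ) (m₀ : Y → ℝ) (U₀ : Y → (B → Matrix.specialUnitaryGroup (Fin N) ℂ))
    {i₀ lam δ' : ℝ} (hF0 : ∀ x, 0 ≤ F x) (hG0 : ∀ x, 0 ≤ G x) (hw0 : ∀ y, 0 ≤ w y) (hlam : 0 ≤ lam) (hδ : 0 ≤ δ')
    (hF : ∀ x y, F x ≠ 0 → w y ≠ 0 → ∃ b : B, δ' ≤ ‖(((U₀ y b)⁻¹ * x b : Matrix.specialUnitaryGroup (Fin N) ℂ) : Matrix (Fin N) (Fin N) ℂ) - 1‖)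
    (hconv : ∀ x y, F x ≠ 0 → w y ≠ 0 → m₀ y + lam / 2 * ∑ b, ‖(((U₀ y b)⁻¹ * x b : Matrix.specialUnitaryGroup (Fin N) ℂ) : Matrix (Fin N) (Fin N) ℂ) - 1‖ ^ 2 ≤ I (x, y))
    (hGwin : ∀ y v, w y ≠ 0 → v ∈ (Set.univ.pi fun _ : B => {U : Matrix.specialUnitaryGroup (Fin N) ℂ | ‖(U : Matrix (Fin N) (Fin N) ℂ) - 1‖ ≤ η}) → 1 ≤ G (U₀ y * v))
    (hIrel : ∀ y v, w y ≠ 0 → v ∈ (Set.univ.pi fun _ : B => {U : Matrix.specialUnitaryGroup (Fin N) ℂ | ‖(U : Matrix (Fin N) (Fin N) ℂ) - 1‖ ≤ η}) → I (U₀ y * v, y) ≤ m₀ y + i₀)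
    (hWpos : 0 < ((Measure.pi fun _ : B => haarProbability (Matrix.specialUnitaryGroup (Fin N) ℂ))
      (Set.univ.pi fun _ : B => {U : Matrix.specialUnitaryGroup (Fin N) ℂ | ‖(U : Matrix (Fin N) (Fin N) ℂ) - 1‖ ≤ η})).toReal)
    (hvol : -Real.log ((Measure.pi fun _ : B => haarProbability (Matrix.specialUnitaryGroup (Fin N) ℂ))
      (Set.univ.pi fun _ : B => {U : Matrix.specialUnitaryGroup (Fin N) ℂ | ‖(U : Matrix (Fin N) (Fin N) ℂ) - 1‖ ≤ η})).toReal ≤ bvol)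
    (hFi : Integrable F (Measure.pi fun _ : B => haarProbability (Matrix.specialUnitaryGroup (Fin N) ℂ)))
    (hGI : ∀ y, w y ≠ 0 → Integrable (fun x => G x * exp (-I (x, y))) (Measure.pi fun _ : B => haarProbability (Matrix.specialUnitaryGroup (Fin N) ℂ)))
    (hA' : Integrable (fun z : (B → Matrix.specialUnitaryGroup (Fin N) ℂ) × Y => F z.1 * w z.2 * exp (-I z)) ((Measure.pi fun _ : B => haarProbability (Matrix.specialUnitaryGroup (Fin N) ℂ)).prod μ))
    (hB' : Integrable (fun z : (B → Matrix.specialUnitaryGroup (Fin N) ℂ) × Y => G z.1 * w z.2 * exp (-I z)) ((Measure.pi fun _ : B => haarProbability (Matrix.specialUnitaryGroup (Fin N) ℂ)).prod μ)) :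
    ∫ z, F z.1 * w z.2 * exp (-I z) ∂((Measure.pi fun _ : B => haarProbability (Matrix.specialUnitaryGroup (Fin N) ℂ)).prod μ) ≤
      exp (i₀ - lam / 2 * δ' ^ 2 + bvol) * (∫ x, F x ∂(Measure.pi fun _ : B => haarProbability (Matrix.specialUnitaryGroup (Fin N) ℂ))) *
        ∫ z, G z.1 * w z.2 * exp (-I z) ∂((Measure.pi fun _ : B => haarProbability (Matrix.specialUnitaryGroup (Fin N) ℂ)).prod μ) := by
  set κ : Measure (B → Matrix.specialUnitaryGroup (Fin N) ℂ) := Measure.pi fun _ : B => haarProbability (Matrix.specialUnitaryGroup (Fin N) ℂ) with hκ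
  set W : Set (B → Matrix.specialUnitaryGroup (Fin N) ℂ) := Set.univ.pi fun _ : B => {U : Matrix.specialUnitaryGroup (Fin N) ℂ | ‖(U : Matrix (Fin N) (Fin N) ℂ) - 1‖ ≤ η} with hW
  have hWm : MeasurableSet W := MeasurableSet.univ_pi fun _ => measurableSet_sball η
  have hWpos' : 0 < κ.real W := by rw [measureReal_def]; exact hWpos
  have hvol' : -Real.log (κ.real W) ≤ bvol := by rw [measureReal_def]; exact hvol
  -- the floor rides in the level: `m y := m₀ y + (λ∕2)δ′²`, excess `i₀ − (λ∕2)δ′²`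
  have hnum : ∀ x y, F x ≠ 0 → w y ≠ 0 → m₀ y + lam / 2 * δ' ^ 2 ≤ I (x, y) := by
    intro x y hx hy
    obtain ⟨b, hb⟩ := hF x y hx hy
    have hsq : δ' ^ 2 ≤ ∑ b, ‖(((U₀ y b)⁻¹ * x b : Matrix.specialUnitaryGroup (Fin N) ℂ) : Matrix (Fin N) (Fin N) ℂ) - 1‖ ^ 2 :=
      (pow_le_pow_left₀ hδ hb 2).trans
        (Finset.single_le_sum (f := fun b => ‖(((U₀ y b)⁻¹ * x b : Matrix.specialUnitaryGroup (Fin N) ℂ) : Matrix (Fin N) (Fin N) ℂ) - 1‖ ^ 2) (fun b _ => sq_nonneg _)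
          (Finset.mem_univ b))
    have := mul_le_mul_of_nonneg_left hsq (by positivity : 0 ≤ lam / 2)
    linarith [hconv x y hx hy]
  have hIrel' : ∀ y v, w y ≠ 0 → v ∈ W → I (U₀ y * v, y) ≤ (m₀ y + lam / 2 * δ' ^ 2) + (i₀ - lam / 2 * δ' ^ 2) := by
    intro y v hy hv
    have := hIrel y v hy hv
    linarith
  have key := relFibre_moment_le_of_centredWindow κ μ F G w I (fun y => m₀ y + lam / 2 * δ' ^ 2) U₀ W hF0 hG0 hw0 hWm hWpos' hnum hGwin hIrel' hFi hGI hA' hB'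
  have hint : 0 ≤ ∫ z, G z.1 * w z.2 * exp (-I z) ∂(κ.prod μ) := integral_nonneg fun z => mul_nonneg (mul_nonneg (hG0 _) (hw0 _)) (exp_pos _).le
  have hFint : 0 ≤ ∫ x, F x ∂κ := integral_nonneg hF0
  have hstep := price_with_volume_le (c := i₀ - lam / 2 * δ' ^ 2) hFint hWpos' hvol'
  exact key.trans (mul_le_mul_of_nonneg_right hstep hint)

/-- **BY VALUE TODAY** (V20 `CompactFibreWindowSUN.exists_neg_log_pi_sball_le`, exponent `N²`; `CompactFibreWindowSUNRate.exists_neg_log_pi_sball_le_sharp` gives `N² − 1` by the same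
line): there is `C > 0` such that for every `0 < η ≤ 2` the hypotheses of `creationPrice_SUN_of_volumeLetter` other than the letter give
`∫ F·w·e^{−I} ≤ exp(i₀ − (λ∕2)δ′² + #bonds·(N²·log(2∕η) − log C))·(∫F dκ)·∫ G·w·e^{−I}`. [folklore] -/
theorem exists_creationPrice_SUN :
    ∃ C : ℝ, 0 < C ∧ ∀ η : ℝ, 0 < η → η ≤ 2 →
      ∀ (F G : (B → Matrix.specialUnitaryGroup (Fin N) ℂ) → ℝ) (w : Y → ℝ) (I : (B → Matrix.specialUnitaryGroup (Fin N) ℂ) × Y → ℝ) (m₀ : Y → ℝ)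
        (U₀ : Y → (B → Matrix.specialUnitaryGroup (Fin N) ℂ)) (i₀ lam δ' : ℝ),
        (∀ x, 0 ≤ F x) → (∀ x, 0 ≤ G x) → (∀ y, 0 ≤ w y) → 0 ≤ lam → 0 ≤ δ' →
        (∀ x y, F x ≠ 0 → w y ≠ 0 → ∃ b : B, δ' ≤ ‖(((U₀ y b)⁻¹ * x b : Matrix.specialUnitaryGroup (Fin N) ℂ) : Matrix (Fin N) (Fin N) ℂ) - 1‖) →
        (∀ x y, F x ≠ 0 → w y ≠ 0 → m₀ y + lam / 2 * ∑ b, ‖(((U₀ y b)⁻¹ * x b : Matrix.specialUnitaryGroup (Fin N) ℂ) : Matrix (Fin N) (Fin N) ℂ) - 1‖ ^ 2 ≤ I (x, y)) →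
        (∀ y v, w y ≠ 0 → v ∈ (Set.univ.pi fun _ : B => {U : Matrix.specialUnitaryGroup (Fin N) ℂ | ‖(U : Matrix (Fin N) (Fin N) ℂ) - 1‖ ≤ η}) → 1 ≤ G (U₀ y * v)) →
        (∀ y v, w y ≠ 0 → v ∈ (Set.univ.pi fun _ : B => {U : Matrix.specialUnitaryGroup (Fin N) ℂ | ‖(U : Matrix (Fin N) (Fin N) ℂ) - 1‖ ≤ η}) → I (U₀ y * v, y) ≤ m₀ y + i₀) →
        Integrable F (Measure.pi fun _ : B => haarProbability (Matrix.specialUnitaryGroup (Fin N) ℂ)) →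
        (∀ y, w y ≠ 0 → Integrable (fun x => G x * exp (-I (x, y))) (Measure.pi fun _ : B => haarProbability (Matrix.specialUnitaryGroup (Fin N) ℂ))) →
        Integrable (fun z : (B → Matrix.specialUnitaryGroup (Fin N) ℂ) × Y => F z.1 * w z.2 * exp (-I z)) ((Measure.pi fun _ : B => haarProbability (Matrix.specialUnitaryGroup (Fin N) ℂ)).prod μ) →
        Integrable (fun z : (B → Matrix.specialUnitaryGroup (Fin N) ℂ) × Y => G z.1 * w z.2 * exp (-I z)) ((Measure.pi fun _ : B => haarProbability (Matrix.specialUnitaryGroup (Fin N) ℂ)).prod μ) →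
        ∫ z, F z.1 * w z.2 * exp (-I z) ∂((Measure.pi fun _ : B => haarProbability (Matrix.specialUnitaryGroup (Fin N) ℂ)).prod μ) ≤
          exp (i₀ - lam / 2 * δ' ^ 2 + (Fintype.card B : ℝ) * ((N * N : ℝ) * Real.log (2 / η) - Real.log C)) *
            (∫ x, F x ∂(Measure.pi fun _ : B => haarProbability (Matrix.specialUnitaryGroup (Fin N) ℂ))) *
            ∫ z, G z.1 * w z.2 * exp (-I z) ∂((Measure.pi fun _ : B => haarProbability (Matrix.specialUnitaryGroup (Fin N) ℂ)).prod μ) := by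
  obtain ⟨C, hC, h⟩ := exists_neg_log_pi_sball_le (N := N) (B := B)
  refine ⟨C, hC, fun η hη hη2 F G w I m₀ U₀ i₀ lam δ' hF0 hG0 hw0 hlam hδ hF hconv hGwin hIrel hFi hGI hA' hB' => ?_⟩
  obtain ⟨hpos, hlog⟩ := h η hη hη2
  exact creationPrice_SUN_of_volumeLetter μ F G w I m₀ U₀ hF0 hG0 hw0 hlam hδ hF hconv hGwin hIrel hpos hlog hFi hGI hA' hB'

/-- **WHEN THE STEP SELLS `e^{−P}`** (letter abstract): with `∫F dκ ≤ 1` the factor of `creationPrice_SUN_of_volumeLetter` is at most `e^{−P}` as soon as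
`P + i₀ + b_vol ≤ (λ∕2)δ′²` — the ledger row (V24 `price_le_exp_neg_of_volumeLetter`'s shape; with `b_vol = #bonds·((N² − 1)·log η⁻¹ + c)`, `#bonds ∝ ℓ^{4r₀}`,
`CreationLedgerPowerCounting` v2's `creation_ledger_print_regime_SUN`). [folklore] -/
theorem creationPrice_factor_le_exp_neg_of_volumeLetter {i₀ lam δ' A P bvol : ℝ} (hA1 : A ≤ 1) (hledger : P + i₀ + bvol ≤ lam / 2 * δ' ^ 2) :
    exp (i₀ - lam / 2 * δ' ^ 2 + bvol) * A ≤ exp (-P) :=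
  calc exp (i₀ - lam / 2 * δ' ^ 2 + bvol) * A ≤ exp (i₀ - lam / 2 * δ' ^ 2 + bvol) * 1 := mul_le_mul_of_nonneg_left hA1 (exp_pos _).le
    _ ≤ exp (-P) := by rw [mul_one]; exact Real.exp_le_exp.2 (by linarith)

/-! ## §2 The same price in print's PROFILE shape (no window letter, no `i₀`) -/

/-- **THE PRICE IN PRINT'S PROFILE SHAPE, `SU(N)`, ALL `N`** ([Balaban1989LargeFieldII] p. 356 (1.2): the denominator's Gaussian INTEGRATED over the window): if on the centred product
Hilbert–Schmidt window the interaction exceeds the base level by at most a PROFILE `q` of the relative position (`hIprof`, `∫_W e^{−q} dκ > 0`), and the numerator carries the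
window-complement floor as in §1, then `∫ F·w·e^{−I} ≤ e^{−(λ∕2)δ′²}·(∫F dκ ∕ ∫_W e^{−q} dκ)·∫ G·w·e^{−I}` (leaf-01's `relFibre_moment_le_of_centredProfile` BY NAME). [folklore] -/
theorem creationPrice_SUN_profile {η : ℝ} (F G : (B → Matrix.specialUnitaryGroup (Fin N) ℂ) → ℝ) (w : Y → ℝ)
    (I : (B → Matrix.specialUnitaryGroup (Fin N) ℂ) × Y → ℝ) (m₀ : Y → ℝ) (U₀ : Y → (B → Matrix.specialUnitaryGroup (Fin N) ℂ))
    (q : (B → Matrix.specialUnitaryGroup (Fin N) ℂ) → ℝ) {lam δ' : ℝ} (hF0 : ∀ x, 0 ≤ F x) (hG0 : ∀ x, 0 ≤ G x) (hw0 : ∀ y, 0 ≤ w y) (hlam : 0 ≤ lam) (hδ : 0 ≤ δ')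
    (hqpos : 0 < ∫ v in (Set.univ.pi fun _ : B => {U : Matrix.specialUnitaryGroup (Fin N) ℂ | ‖(U : Matrix (Fin N) (Fin N) ℂ) - 1‖ ≤ η}), exp (-q v) ∂(Measure.pi fun _ : B => haarProbability (Matrix.specialUnitaryGroup (Fin N) ℂ)))
    (hF : ∀ x y, F x ≠ 0 → w y ≠ 0 → ∃ b : B, δ' ≤ ‖(((U₀ y b)⁻¹ * x b : Matrix.specialUnitaryGroup (Fin N) ℂ) : Matrix (Fin N) (Fin N) ℂ) - 1‖)
    (hconv : ∀ x y, F x ≠ 0 → w y ≠ 0 → m₀ y + lam / 2 * ∑ b, ‖(((U₀ y b)⁻¹ * x b : Matrix.specialUnitaryGroup (Fin N) ℂ) : Matrix (Fin N) (Fin N) ℂ) - 1‖ ^ 2 ≤ I (x, y))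
    (hGwin : ∀ y v, w y ≠ 0 → v ∈ (Set.univ.pi fun _ : B => {U : Matrix.specialUnitaryGroup (Fin N) ℂ | ‖(U : Matrix (Fin N) (Fin N) ℂ) - 1‖ ≤ η}) → 1 ≤ G (U₀ y * v))
    (hIprof : ∀ y v, w y ≠ 0 → v ∈ (Set.univ.pi fun _ : B => {U : Matrix.specialUnitaryGroup (Fin N) ℂ | ‖(U : Matrix (Fin N) (Fin N) ℂ) - 1‖ ≤ η}) → I (U₀ y * v, y) ≤ m₀ y + q v)
    (hFi : Integrable F (Measure.pi fun _ : B => haarProbability (Matrix.specialUnitaryGroup (Fin N) ℂ)))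
    (hGI : ∀ y, w y ≠ 0 → Integrable (fun x => G x * exp (-I (x, y))) (Measure.pi fun _ : B => haarProbability (Matrix.specialUnitaryGroup (Fin N) ℂ)))
    (hA' : Integrable (fun z : (B → Matrix.specialUnitaryGroup (Fin N) ℂ) × Y => F z.1 * w z.2 * exp (-I z)) ((Measure.pi fun _ : B => haarProbability (Matrix.specialUnitaryGroup (Fin N) ℂ)).prod μ))
    (hB' : Integrable (fun z : (B → Matrix.specialUnitaryGroup (Fin N) ℂ) × Y => G z.1 * w z.2 * exp (-I z)) ((Measure.pi fun _ : B => haarProbability (Matrix.specialUnitaryGroup (Fin N) ℂ)).prod μ)) :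
    ∫ z, F z.1 * w z.2 * exp (-I z) ∂((Measure.pi fun _ : B => haarProbability (Matrix.specialUnitaryGroup (Fin N) ℂ)).prod μ) ≤
      (exp (-(lam / 2 * δ' ^ 2)) *
        ((∫ x, F x ∂(Measure.pi fun _ : B => haarProbability (Matrix.specialUnitaryGroup (Fin N) ℂ))) /
          ∫ v in (Set.univ.pi fun _ : B => {U : Matrix.specialUnitaryGroup (Fin N) ℂ | ‖(U : Matrix (Fin N) (Fin N) ℂ) - 1‖ ≤ η}), exp (-q v) ∂(Measure.pi fun _ : B => haarProbability (Matrix.specialUnitaryGroup (Fin N) ℂ)))) *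
        ∫ z, G z.1 * w z.2 * exp (-I z) ∂((Measure.pi fun _ : B => haarProbability (Matrix.specialUnitaryGroup (Fin N) ℂ)).prod μ) := by
  set κ : Measure (B → Matrix.specialUnitaryGroup (Fin N) ℂ) := Measure.pi fun _ : B => haarProbability (Matrix.specialUnitaryGroup (Fin N) ℂ) with hκ
  set W : Set (B → Matrix.specialUnitaryGroup (Fin N) ℂ) := Set.univ.pi fun _ : B => {U : Matrix.specialUnitaryGroup (Fin N) ℂ | ‖(U : Matrix (Fin N) (Fin N) ℂ) - 1‖ ≤ η} with hW
  set a : ℝ := lam / 2 * δ' ^ 2 with ha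
  have hWm : MeasurableSet W := MeasurableSet.univ_pi fun _ => measurableSet_sball η
  have hsplit : ∫ v in W, exp (-(q v - a)) ∂κ = exp a * ∫ v in W, exp (-q v) ∂κ := by
    rw [← integral_const_mul]
    refine integral_congr_ae (ae_of_all _ fun v => ?_)
    show exp (-(q v - a)) = exp a * exp (-q v)
    rw [← Real.exp_add]; ring_nf
  have hqpos' : 0 < ∫ v in W, exp (-(q v - a)) ∂κ := by rw [hsplit]; positivity
  have hnum : ∀ x y, F x ≠ 0 → w y ≠ 0 → m₀ y + a ≤ I (x, y) := by
    intro x y hx hy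
    obtain ⟨b, hb⟩ := hF x y hx hy
    have hsq : δ' ^ 2 ≤ ∑ b, ‖(((U₀ y b)⁻¹ * x b : Matrix.specialUnitaryGroup (Fin N) ℂ) : Matrix (Fin N) (Fin N) ℂ) - 1‖ ^ 2 :=
      (pow_le_pow_left₀ hδ hb 2).trans
        (Finset.single_le_sum (f := fun b => ‖(((U₀ y b)⁻¹ * x b : Matrix.specialUnitaryGroup (Fin N) ℂ) : Matrix (Fin N) (Fin N) ℂ) - 1‖ ^ 2) (fun b _ => sq_nonneg _)
          (Finset.mem_univ b))
    have := mul_le_mul_of_nonneg_left hsq (by positivity : 0 ≤ lam / 2)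
    rw [ha]; linarith [hconv x y hx hy]
  have hIprof' : ∀ y v, w y ≠ 0 → v ∈ W → I (U₀ y * v, y) ≤ (m₀ y + a) + (q v - a) := by
    intro y v hy hv
    have := hIprof y v hy hv
    linarith
  have key := relFibre_moment_le_of_centredProfile κ μ F G w I (fun y => m₀ y + a) U₀ W (fun v => q v - a) hF0 hG0 hw0 hWm hqpos' hnum hGwin hIprof' hFi hGI hA' hB'
  rw [hsplit] at key
  have hrew : (∫ x, F x ∂κ) / (exp a * ∫ v in W, exp (-q v) ∂κ) = exp (-a) * ((∫ x, F x ∂κ) / ∫ v in W, exp (-q v) ∂κ) := by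
    rw [Real.exp_neg, div_mul_eq_div_div, ← inv_mul_eq_div (exp a)]
    ring
  rw [hrew] at key
  exact key

/-! ## §3 Sanity -/

/-- The ledger row with no window excess and no letter (`i₀ = b_vol = 0`): `P ≤ (λ∕2)δ′²` sells `e^{−P}`. -/
example {lam δ' P : ℝ} (h : P ≤ lam / 2 * δ' ^ 2) : exp (0 - lam / 2 * δ' ^ 2 + 0) * (1 : ℝ) ≤ exp (-P) :=
  creationPrice_factor_le_exp_neg_of_volumeLetter le_rfl (by linarith)

end Summit.QuantumFields.BalabanUV.T4Continuum.NE7b.CompactFibreCreationFloorSUN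

end
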